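import Summits.CriticalPhenomena.PercolationContinuityZ3.Theorems.PercNearOneGluingNoHeavyLowerTailSahiFreeSlotFourData
import HarnessLib

/-!
# `NoHeavyLowerTail` (stmt-CriticalPhenomena-4575) — free-slot region reduction at order 4: THE CERTIFICATE (`native_decide`)

Support file, seat `prim-l12-p5` (gen 17), `--supports stmt-CriticalPhenomena-4575`.  COMPUTATIONAL: one `native_decide` evaluating
`SahiFreeSlot.checkAll` of `…SahiFreeSlotFourData`: (i) the node/pattern enumerations have no duplicates, (ii) `z_O ≥ 0` on `[0,1]^7`
(pruned Bernstein slicing `boxcheckK` of `…SahiHittingBoxRecursive`), (iii) for each of the 1 691 up-closed families `𝒟` of deficient nodes the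
7-variable polynomial `ν_𝒟 = Σ_{R ∈ 𝒟∪N(𝒟)} z_{patt R} P_R` (multidegree ≤ (2,2,2,3,3,3,4)) passes the degree guard and `boxcheckK`
(all tensor-Bernstein coefficients are in fact ≥ 0; ≈ 110 s on the farm).  Consumed by `…SahiFreeSlotFour` through
`SahiFreeSlot.sum_upper_nonneg_of_checkAll`.  Memo FROM-prim-l12-p5-g17-FREE-SLOT-REGION-REDUCTION §1(vi). [this work]
-/

namespace Summit.CriticalPhenomena.PercolationContinuityZ3.Theorems

namespace SahiFreeSlot

/-- **The certificate passes** — stated as the unfolded conjunction of `checkAll` (no duplicate nodes/patterns; `z_O ≥ 0` on the box; all 1 691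
family polynomials `ν_𝒟` pass the degree guard and `boxcheckK`); definitionally equal to `checkAll = true`, which is how it is consumed (`sum_upper_nonneg_of_checkAll freeSlotFour_cert`). [this work] -/
theorem freeSlotFour_cert :
    ((decide allNodes.Nodup && decide allPatts.Nodup) &&
      ((degOK (zWK Finset.univ) && SahiHitting.boxcheckK vs7 (zWK Finset.univ)) && families.all checkFam)) = true := by
  native_decide


/-- **The up-set inequalities, unconditionally**: for every `r ∈ [0,1]^7` and every up-closed family `𝒰` of open-region sets,
`0 ≤ Σ_{R∈𝒰} z_{patt R}(r) · cellProb r R` (memo §1(iv)–(vi): this is F(4,1)∀X on the 7-coin Venn cube). [this work] -/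
theorem sum_upper_nonneg (x : Fin 7 → ℝ) (hx : ∀ i, 0 ≤ x i ∧ x i ≤ 1) (U : Finset (Finset (Fin 7)))
    (hU : ∀ R ∈ U, ∀ R', R ⊆ R' → R' ∈ U) :
    0 ≤ ∑ R ∈ U, SahiHitting.evalKL 7 (zWK (patt R)) x * cellProb x R :=
  sum_upper_nonneg_of_checkAll freeSlotFour_cert x hx U hU

end SahiFreeSlot

end Summit.CriticalPhenomena.PercolationContinuityZ3.Theorems
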